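import Summits.BirchSwinnertonDyer.Rank1Residual.GaloisImage.WildThreeAdicTower
import Summits.BirchSwinnertonDyer.Rank1Residual.GaloisImage.ThreeAdicTowerInertiaCriterion
import HarnessLib

/-!
# The wild `3`-adic tower AT Elkies' value `v₃(j − 1728) = 3` on the rows whose `3`-torsion is
# TAMELY ramified at `3` (cell `b2b-bsdres`, team n1011, seat p14 gen 3, OWNERS row T-b11 'EXOTIC
# core at m = 3'; sequel of n1011-p02's `GaloisImage/WildThreeAdicTower.lean` (`m ∈ {1,2,4}`) over his
# inertia criterion `GaloisImage/ThreeAdicTowerInertiaCriterion.lean`)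

HONEST FRAMING (cell `b2b-bsdres`, run/shared/lean/b2b/bsd-rank1-residual/, verbatim in every
file): the goal of the cell is to DELETE the COMBINATION-SHAPED residual classes of the
Birch–Swinnerton-Dyer formula for ALL analytic-rank `≤ 1` elliptic curves over `ℚ` — "full BSD
formula for every rank `≤ 1` curve in class `C`" assembled STRICTLY from published theorems — so
that the rank-`≤ 1` remainder becomes exactly the CONSTRUCTION-SHAPED classes, which are TYPED
(missing-input `Prop`s), NOT attempted. This is not "finishing BSD". Team n1011 (N10 / N11, the
additive block X4 ∧ `p = 3`): research route on the CONSTRUCTION-SHAPED class X4; no claim beyond the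
stated classes; nothing is booked. Theorems only (no definition, no named fact).

## What this file proves

At `m = v₃(j − 1728) = 3` — the value carried by every EXOTIC row of X4 at `3`
(`Additive/X4ExoticThree.lean`) — n1011-p02's `9`-torsion ordinate `z` has `108·val(z) = 27·v₃(Δ) − 3`
(`exists_nineTorsion_csOrdinate_valuation`, valid for `1 ≤ m ≤ 4`), i.e. a `3`-adic valuation with
denominator `36`: divisible by `9` but NOT by `27`, so the `27`-criterion of ARM A is silent (and must
be: Elkies' curves live here).  The `9`-criterion WITH TAMENESS of `ρ̄_{E,3}` on inertia
(`forall_hasSurjectiveModNGaloisRep_three_pow_of_surj_of_valuation_of_not_three_dvd`) does apply: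

* `exists_mem_divisionField_nine_valuation_pow_9_of_eq_three` — for `v₃(j − 1728) = 3` a non-zero
  `w ∈ ℚ(E[9])` (namely `z⁴`) with `v(w)⁹ · v(3)^{1 + 9·v₃(den Δ)} = v(3)^{9·v₃(num Δ)}` (cube roots
  are unique in the value group), `9` coprime to the exponent difference;
* **`towerSurj_three_of_surj_of_padicValRat_j_sub_eq_three_of_not_three_dvd`** — `ρ̄_{E,3}` onto,
  `v₃(j − 1728) = 3`, and `3 ∤ #ρ̄_{E,3}(I_𝔓)` for the inertia group at a prime `𝔓 ∣ 3` of `ℚ̄`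
  (the `3`-division field TAMELY ramified at `3`) ⟹ `ρ̄_{E,3ⁿ}` onto for every `n`.

Census reading (EVIDENCE, `HOME/b2b-bsdres-n1011-p14/e11/EXO3-LOCAL-WITNESS.md`, kit job j131848):
of the 341 `r_an = 0` EXOTIC-candidate cells (all `m = 3`), 25 (7 distinct `j`, all with `f₃ = 3`:
`j/3^{v₃ j} ≡ ±1 (mod 9)`) have `ℚ₃(x(E[3]))/ℚ₃` of degree `2` — tame `3`-torsion — and are covered
by this theorem modulo the per-pair tameness input; the other 316 have `e(ℚ₃(x E[3])) = 6`.  Nothing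
booked; X4 CONSTRUCTION-SHAPED; no label change.

References: J.-P. Serre, *Corps locaux*, I §7 Prop. 21–22; J.-P. Serre, *Abelian ℓ-adic
representations* (1968) IV-23 Lemma 3; N. Elkies, arXiv:math/0612734.
-/

noncomputable section

open scoped Classical NumberField Pointwise

open Field IsDedekindDomain WeierstrassCurve Rat.HeightOneSpectrum

namespace Summit.BirchSwinnertonDyer.Rank1Residual.GaloisImage

open Literature.NumberTheory.EllipticCurves Literature.NumberTheory.GaloisRepresentations

variable (W : WeierstrassCurve ℚ) [W.IsElliptic]

/-- **The `9`-socket at `m = 3`.**  For `E/ℚ` with `v₃(j − 1728) = 3` there is a non-zero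
`w ∈ ℚ(E[9])` — the fourth power of the completed-square ordinate of n1011-p02's `9`-torsion point
above a non-canonical `3`-torsion point — with `v(w)⁹ · v(3)^{1 + 9a} = v(3)^{9b}`
(`a = v₃(den Δ)`, `b = v₃(num Δ)`; from `108·val(z) = 27 v₃(Δ) − 3` by uniqueness of cube roots in
the linearly ordered value group), and `9` is coprime to `(1 + 9a) − 9b`. [folklore] -/
theorem exists_mem_divisionField_nine_valuation_pow_9_of_eq_three
    (hj : padicValRat 3 (W.j - 1728) = (3 : ℕ)) :
    ∃ (w : AlgebraicClosure ℚ) (a b : ℕ), w ∈ W.divisionField 9 ∧ w ≠ 0 ∧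
      (placeOver 3).valuation w ^ 9 * (placeOver 3).valuation (3 : AlgebraicClosure ℚ) ^ a =
        (placeOver 3).valuation (3 : AlgebraicClosure ℚ) ^ b ∧
      IsCoprime (9 : ℤ) ((a : ℤ) - b) := by
  obtain ⟨Q, x, y, h, hQ, hQ9, hz0, hval⟩ :=
    exists_nineTorsion_csOrdinate_valuation W (m := 3) (by norm_num) (by norm_num) hj
  haveI : NeZero (9 : ℕ) := ⟨by norm_num⟩
  have hQ' : Q ∈ geomTorsion W ((9 : ℕ) : ℤ) := (mem_geomTorsion_iff W _ Q).mpr (by exact_mod_cast hQ9)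
  obtain ⟨hxL, hyL⟩ := W.mem_divisionField_of_eq_some (n := 9) (T := ⟨Q, hQ'⟩) hQ
  set z := y + (algebraMap ℚ (AlgebraicClosure ℚ) W.a₁ * x +
    algebraMap ℚ (AlgebraicClosure ℚ) W.a₃) / 2 with hz
  have hzL : z ∈ W.divisionField 9 := by
    refine add_mem hyL (div_mem (add_mem (mul_mem ?_ hxL) ?_) ?_)
    · exact IntermediateField.algebraMap_mem _ _
    · exact IntermediateField.algebraMap_mem _ _
    · exact IntermediateField.natCast_mem _ 2
  set v := (placeOver 3).valuation with hv
  set t := v (3 : AlgebraicClosure ℚ) with ht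
  -- `(v(z⁴)⁹ · t^{1 + 9a})³ = v(z)¹⁰⁸ · t^{3 + 27a} = t^{27b} = (t^{9b})³`
  have hcube : (v (z ^ 4) ^ 9 * t ^ (1 + 9 * padicValNat 3 W.Δ.den)) ^ 3 =
      (t ^ (9 * padicValInt 3 W.Δ.num)) ^ 3 := by
    rw [mul_pow, ← pow_mul, ← pow_mul, ← pow_mul, map_pow, ← pow_mul]
    have e1 : 4 * (9 * 3) = 108 := by norm_num
    have e2 : (1 + 9 * padicValNat 3 W.Δ.den) * 3 = 3 + 27 * padicValNat 3 W.Δ.den := by ring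
    have e3 : 9 * padicValInt 3 W.Δ.num * 3 = 27 * padicValInt 3 W.Δ.num := by ring
    rw [e1, e2, e3]
    exact hval
  have hval9 : v (z ^ 4) ^ 9 * t ^ (1 + 9 * padicValNat 3 W.Δ.den) =
      t ^ (9 * padicValInt 3 W.Δ.num) :=
    (pow_left_strictMonoOn₀ (by norm_num : (3 : ℕ) ≠ 0)).injOn
      (by simp) (by simp) hcube
  refine ⟨z ^ 4, 1 + 9 * padicValNat 3 W.Δ.den, 9 * padicValInt 3 W.Δ.num, pow_mem hzL 4,
    pow_ne_zero _ hz0, hval9, ?_⟩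
  have e : ((1 + 9 * padicValNat 3 W.Δ.den : ℕ) : ℤ) - ((9 * padicValInt 3 W.Δ.num : ℕ) : ℤ) =
      1 + 9 * ((padicValNat 3 W.Δ.den : ℤ) - padicValInt 3 W.Δ.num) := by
    push_cast; ring
  rw [e]
  refine IsCoprime.add_mul_left_right ?_ _
  exact isCoprime_one_right

/-- **THE `3`-ADIC TOWER AT `v₃(j − 1728) = 3` WHEN `E[3]` IS TAME AT `3`.**  Let `E/ℚ` be an
elliptic curve (any Weierstrass model) with `v₃(j(E) − 1728) = 3` and `ρ̄_{E,3} : Γ_ℚ → GL₂(𝔽₃)`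
onto, and let `𝔓` be a prime of `ℚ̄` over `3` (place data `(v, 𝔓)` as in
`ThreeAdicTowerInertiaCriterion`) such that `3 ∤ #ρ̄_{E,3}(I_𝔓)` — the `3`-division field is tamely
ramified at `3`.  Then `ρ̄_{E,3ⁿ}` is onto for every `n`.  Proof: the socket above gives
`9 ∣ #ρ̄_{E,9}(I_𝔓)` (an element of `ℚ(E[9])` whose valuation has denominator divisible by `9`,
Serre *Corps locaux* I §7), so `#ker(ρ̄_{E,9}(I_𝔓) → ρ̄_{E,3}(I_𝔓)) ≥ 9 > 3 = #(scalars ≡ 1 mod 3)`: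
an element of inertia trivial on `E[3]` and non-scalar on `E[9]`, whence the tower (Serre IV-23 as
in n1011-p02's criterion).  At `m = 3` WITHOUT the tameness input nothing is claimed — Elkies'
`9`-deficient curves (`ρ̄₃` onto, `ρ̄₉` not) all have `v₃(j − 1728) = 3` and WILD `E[3]` at `3`.
[cite: SerreLocalFields1979, Ch. I §7 Cor. to Prop. 21 and Prop. 22(b)]
[cite: SerreAbelianLadic1968, Ch. IV §3.4, Lemma 3 (IV-23)] -/
theorem towerSurj_three_of_surj_of_padicValRat_j_sub_eq_three_of_not_three_dvd
    (hj : padicValRat 3 (W.j - 1728) = (3 : ℕ)) (hsurj : W.HasSurjectiveModNGaloisRep 3)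
    {v : HeightOneSpectrum (𝓞 ℚ)} (hv : (primesEquiv v : ℕ) = 3)
    {𝔓 : Ideal (absIntegers (𝓞 ℚ) ℚ)}
    (hmem : ∀ x : absIntegers (𝓞 ℚ) ℚ, x ∈ 𝔓 ↔ (x : AlgebraicClosure ℚ) ∈ (placeOver 3).nonunits)
    (h𝔓 : 𝔓 ∈ v.primesAbove)
    (h3 : ¬ 3 ∣ Nat.card ((𝔓.inertia (absoluteGaloisGroup ℚ)).map (galoisRepTorsion W 3)))
    (n : ℕ) : W.HasSurjectiveModNGaloisRep (3 ^ n : ℕ) := by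
  obtain ⟨w, a, b, hwL, hw0, hval, hcop⟩ :=
    exists_mem_divisionField_nine_valuation_pow_9_of_eq_three W hj
  exact forall_hasSurjectiveModNGaloisRep_three_pow_of_surj_of_valuation_of_not_three_dvd W hsurj hv
    hmem h𝔓 h3 hwL hw0 hval hcop (dvd_refl 9) n

end Summit.BirchSwinnertonDyer.Rank1Residual.GaloisImage

end
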